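import Summits.MatrixMultiplication.MatrixMultiplication.Theorems.ThinPackings.Negative.ThinPackingsPacking

/-!
# Difference cores: no leg of a thin near-tight STPP family is a family of translates
(crux stmt-MatrixMultiplication-10595, negative side, II)

For an STPP family `(Aᵢ, Bᵢ, Cᵢ)` in an abelian group and a set `P` whose difference set lies in
EVERY `Aᵢ − Aᵢ` (an "A-difference core"), the map `(i, t, u, p) ↦ t − u + p` is injective on
`⨆ᵢ Bᵢ × Cᵢ × P` (STPP clause `k = i ≠ j`), so `(Σᵢ |Bᵢ||Cᵢ|)·|P| ≤ |H|`; likewise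
`(Σᵢ |Aᵢ||Bᵢ|)·|Q| ≤ |H|` for a C-core `Q` (clause `j = k ≠ i`) and `(Σᵢ |Aᵢ||Cᵢ|)·|R| ≤ |H|`
for a B-core `R` (clause `i = j ≠ k`; `R = {pt}` is the two-leg packing bound).  For the thin
profile `⟨N, M, N⟩` with `|H| ≤ L·N^{2+η}` this gives `M·|P| ≤ N^{1+η}`, `M·|Q| ≤ N^{1+η}`,
`|R| ≤ N^η`; in particular if ONE leg consists of blocks with nested difference sets (e.g.
translates `x_i + P` of one set) then `M ≤ N^η`, i.e. `a ≤ η` — the trivial exponent.  More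
quantitatively, each leg must meet at least `M·N^{−η}` distinct difference-set classes.
-/

namespace Summit.MatrixMultiplication.MatrixMultiplication.Theorems.ThinPackings.Negative

open Literature.Computability.AlgebraicComplexity Finset

section Cores

variable {H : Type*} [AddCommGroup H] {L : ℕ} {A B C : Fin L → Finset H}

/-- A-difference core: `(i, t, u, p) ↦ t − u + p` is injective on `⨆_{i ∈ S} (Bᵢ × Cᵢ) × P`
whenever `P − P ⊆ Aᵢ − Aᵢ` for all `i ∈ S` (STPP clause `k = i ≠ j`). [new, elementary] -/
theorem injOn_BC_core (hS : IsSTPP A B C) (S : Finset (Fin L)) (P : Finset H)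
    (hP : ∀ i ∈ S, ∀ p ∈ P, ∀ p' ∈ P, ∃ s ∈ A i, ∃ s' ∈ A i, p - p' = s' - s) :
    Set.InjOn (fun x : (Σ _ : Fin L, (H × H) × H) => x.2.1.1 - x.2.1.2 + x.2.2)
      ↑(S.sigma fun i => (B i ×ˢ C i) ×ˢ P) := by
  rintro ⟨i, ⟨t, u⟩, p⟩ hx ⟨j, ⟨t', u'⟩, p'⟩ hy he
  rw [mem_coe, mem_sigma, mem_product, mem_product] at hx hy
  change t - u + p = t' - u' + p' at he
  obtain ⟨s, hs, s', hs', hpp⟩ := hP i hx.1 p' hy.2.2 p hx.2.2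
  have h0 : (s' - s) + (t' - t) + (u - u') = 0 := by
    have : (s' - s) + (t' - t) + (u - u') = (t' - u' + p') - (t - u + p) := by rw [← hpp]; abel
    rw [this, he, sub_self]
  obtain ⟨hij, -, -, htt, huu⟩ :=
    hS i j i s hs s' hs' t hx.2.1.1 t' hy.2.1.1 u' hy.2.1.2 u hx.2.1.2 h0
  subst hij htt huu
  have hp : p = p' := add_left_cancel he
  subst hp
  rfl

/-- C-difference core: `(i, s', t, q) ↦ s' − t + q` is injective on `⨆_{i ∈ S} (Aᵢ × Bᵢ) × Q`
whenever `Q − Q ⊆ Cᵢ − Cᵢ` for all `i ∈ S` (STPP clause `j = k ≠ i`). [new, elementary] -/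
theorem injOn_AB_core (hS : IsSTPP A B C) (S : Finset (Fin L)) (Q : Finset H)
    (hQ : ∀ i ∈ S, ∀ q ∈ Q, ∀ q' ∈ Q, ∃ u ∈ C i, ∃ u' ∈ C i, q - q' = u' - u) :
    Set.InjOn (fun x : (Σ _ : Fin L, (H × H) × H) => x.2.1.1 - x.2.1.2 + x.2.2)
      ↑(S.sigma fun i => (A i ×ˢ B i) ×ˢ Q) := by
  rintro ⟨i, ⟨s', t⟩, q⟩ hx ⟨k, ⟨s, t'⟩, q'⟩ hy he
  rw [mem_coe, mem_sigma, mem_product, mem_product] at hx hy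
  change s' - t + q = s - t' + q' at he
  obtain ⟨u, hu, u', hu', hqq⟩ := hQ k hy.1 q hx.2.2 q' hy.2.2
  have h0 : (s' - s) + (t' - t) + (u' - u) = 0 := by
    have : (s' - s) + (t' - t) + (u' - u) = (s' - t + q) - (s - t' + q') := by rw [← hqq]; abel
    rw [this, he, sub_self]
  obtain ⟨hik, -, hss, htt, huu⟩ :=
    hS i k k s hy.2.1.1 s' hx.2.1.1 t hx.2.1.2 t' hy.2.1.2 u hu u' hu' h0
  subst hik hss htt
  have hq : q = q' := by
    have h1 : u' - u = 0 := by rw [huu, sub_self]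
    have h2 : q - q' = 0 := hqq.trans h1
    exact sub_eq_zero.1 h2
  subst hq
  rfl

/-- B-difference core: `(i, s', u, r) ↦ s' − u + r` is injective on `⨆_{i ∈ S} (Aᵢ × Cᵢ) × R`
whenever `R − R ⊆ Bᵢ − Bᵢ` for all `i ∈ S` (STPP clause `i = j ≠ k`); `R = {r}` is the two-leg
packing bound `injOn_sub_AC`. [new, elementary] -/
theorem injOn_AC_core (hS : IsSTPP A B C) (S : Finset (Fin L)) (R : Finset H)
    (hR : ∀ i ∈ S, ∀ r ∈ R, ∀ r' ∈ R, ∃ t ∈ B i, ∃ t' ∈ B i, r - r' = t' - t) :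
    Set.InjOn (fun x : (Σ _ : Fin L, (H × H) × H) => x.2.1.1 - x.2.1.2 + x.2.2)
      ↑(S.sigma fun i => (A i ×ˢ C i) ×ˢ R) := by
  rintro ⟨i, ⟨s', u⟩, r⟩ hx ⟨k, ⟨s, u'⟩, r'⟩ hy he
  rw [mem_coe, mem_sigma, mem_product, mem_product] at hx hy
  change s' - u + r = s - u' + r' at he
  obtain ⟨t, ht, t', ht', hrr⟩ := hR i hx.1 r hx.2.2 r' hy.2.2
  have h0 : (s' - s) + (t' - t) + (u' - u) = 0 := by
    have : (s' - s) + (t' - t) + (u' - u) = (s' - u + r) - (s - u' + r') := by rw [← hrr]; abel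
    rw [this, he, sub_self]
  obtain ⟨-, hik, hss, htt, huu⟩ :=
    hS i i k s hy.2.1.1 s' hx.2.1.1 t ht t' ht' u hx.2.1.2 u' hy.2.1.2 h0
  subst hik hss huu
  have hr : r = r' := by
    have h1 : t' - t = 0 := by rw [htt, sub_self]
    exact sub_eq_zero.1 (hrr.trans h1)
  subst hr
  rfl

variable [Fintype H]

/-- `(Σ_{i∈S} |Bᵢ||Cᵢ|)·|P| ≤ |H|` for an A-difference core `P` on `S`. [new, elementary] -/
theorem sum_card_BC_mul_core_le (hS : IsSTPP A B C) (S : Finset (Fin L)) (P : Finset H)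
    (hP : ∀ i ∈ S, ∀ p ∈ P, ∀ p' ∈ P, ∃ s ∈ A i, ∃ s' ∈ A i, p - p' = s' - s) :
    (∑ i ∈ S, (B i).card * (C i).card) * P.card ≤ Fintype.card H := by
  classical
  calc (∑ i ∈ S, (B i).card * (C i).card) * P.card
        = (S.sigma fun i => (B i ×ˢ C i) ×ˢ P).card := by
          rw [card_sigma, sum_mul]; simp only [card_product]
    _ = ((S.sigma fun i => (B i ×ˢ C i) ×ˢ P).image
          fun x : (Σ _ : Fin L, (H × H) × H) => x.2.1.1 - x.2.1.2 + x.2.2).card :=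
          (card_image_of_injOn (injOn_BC_core hS S P hP)).symm
    _ ≤ Fintype.card H := card_le_univ _

/-- `(Σ_{i∈S} |Aᵢ||Bᵢ|)·|Q| ≤ |H|` for a C-difference core `Q` on `S`. [new, elementary] -/
theorem sum_card_AB_mul_core_le (hS : IsSTPP A B C) (S : Finset (Fin L)) (Q : Finset H)
    (hQ : ∀ i ∈ S, ∀ q ∈ Q, ∀ q' ∈ Q, ∃ u ∈ C i, ∃ u' ∈ C i, q - q' = u' - u) :
    (∑ i ∈ S, (A i).card * (B i).card) * Q.card ≤ Fintype.card H := by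
  classical
  calc (∑ i ∈ S, (A i).card * (B i).card) * Q.card
        = (S.sigma fun i => (A i ×ˢ B i) ×ˢ Q).card := by
          rw [card_sigma, sum_mul]; simp only [card_product]
    _ = ((S.sigma fun i => (A i ×ˢ B i) ×ˢ Q).image
          fun x : (Σ _ : Fin L, (H × H) × H) => x.2.1.1 - x.2.1.2 + x.2.2).card :=
          (card_image_of_injOn (injOn_AB_core hS S Q hQ)).symm
    _ ≤ Fintype.card H := card_le_univ _

/-- `(Σ_{i∈S} |Aᵢ||Cᵢ|)·|R| ≤ |H|` for a B-difference core `R` on `S`. [new, elementary] -/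
theorem sum_card_AC_mul_core_le (hS : IsSTPP A B C) (S : Finset (Fin L)) (R : Finset H)
    (hR : ∀ i ∈ S, ∀ r ∈ R, ∀ r' ∈ R, ∃ t ∈ B i, ∃ t' ∈ B i, r - r' = t' - t) :
    (∑ i ∈ S, (A i).card * (C i).card) * R.card ≤ Fintype.card H := by
  classical
  calc (∑ i ∈ S, (A i).card * (C i).card) * R.card
        = (S.sigma fun i => (A i ×ˢ C i) ×ˢ R).card := by
          rw [card_sigma, sum_mul]; simp only [card_product]
    _ = ((S.sigma fun i => (A i ×ˢ C i) ×ˢ R).image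
          fun x : (Σ _ : Fin L, (H × H) × H) => x.2.1.1 - x.2.1.2 + x.2.2).card :=
          (card_image_of_injOn (injOn_AC_core hS S R hR)).symm
    _ ≤ Fintype.card H := card_le_univ _

end Cores

/-! ## Consequences for the crux matrix `⟨N, M, N⟩`, `2 ≤ N`, `N^a ≤ M`, `|H| ≤ L·N^{2+η}` -/

section Thin

variable {H : Type} [AddCommGroup H] [Fintype H] {L N M : ℕ} {A B C : Fin L → Finset H}
  {a η : ℝ}

omit [Fintype H] in
/-- `Σ_{i∈S} f i · g i = |S|·(x·y)` for constant profiles. [folklore] -/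
theorem sum_profile (S : Finset (Fin L)) {f g : Fin L → ℕ} {x y : ℕ}
    (hf : ∀ i, f i = x) (hg : ∀ i, g i = y) : ∑ i ∈ S, f i * g i = S.card * (x * y) := by
  rw [Finset.sum_congr rfl fun i _ => by rw [hf i, hg i], sum_const, smul_eq_mul]

/-- A-cores are short: `M·|P| ≤ N^{1+η}` for every `P` with `P − P ⊆ ⋂ᵢ (Aᵢ − Aᵢ)`.
[new, elementary] -/
theorem thin_core_A (hS : IsSTPP A B C)
    (hc : ∀ i, (A i).card = N ∧ (B i).card = M ∧ (C i).card = N) (hN : 2 ≤ N)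
    (hH : (Fintype.card H : ℝ) ≤ L * (N : ℝ) ^ (2 + η)) (P : Finset H)
    (hP : ∀ i, ∀ p ∈ P, ∀ p' ∈ P, ∃ s ∈ A i, ∃ s' ∈ A i, p - p' = s' - s) :
    (M : ℝ) * P.card ≤ (N : ℝ) ^ (1 + η) := by
  have hL := one_le_L hH
  have h := sum_card_BC_mul_core_le hS univ P fun i _ => hP i
  rw [sum_profile univ (fun i => (hc i).2.1) (fun i => (hc i).2.2), card_univ, Fintype.card_fin]
    at h
  have hR : (L : ℝ) * (M * N) * P.card ≤ L * (N : ℝ) ^ (2 + η) := by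
    refine le_trans ?_ hH; exact_mod_cast h
  have hLpos : (0 : ℝ) < L := by exact_mod_cast (by omega : 0 < L)
  have hNpos : (0 : ℝ) < N := by exact_mod_cast (by omega : 0 < N)
  have h2 : (M : ℝ) * N * P.card ≤ (N : ℝ) ^ (2 + η) := by
    have := le_of_mul_le_mul_left (by linarith [hR] : (L : ℝ) * (M * N * P.card) ≤ L * N ^ (2 + η))
      hLpos
    linarith
  have h3 : (N : ℝ) ^ (2 + η) = N * (N : ℝ) ^ (1 + η) := by
    rw [show (2 : ℝ) + η = 1 + (1 + η) by ring, Real.rpow_add hNpos, Real.rpow_one]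
  rw [h3] at h2
  have h4 : (N : ℝ) * (M * P.card) ≤ N * (N : ℝ) ^ (1 + η) := by linarith
  exact le_of_mul_le_mul_left h4 hNpos

/-- C-cores are short: `M·|Q| ≤ N^{1+η}` for every `Q` with `Q − Q ⊆ ⋂ᵢ (Cᵢ − Cᵢ)`.
[new, elementary] -/
theorem thin_core_C (hS : IsSTPP A B C)
    (hc : ∀ i, (A i).card = N ∧ (B i).card = M ∧ (C i).card = N) (hN : 2 ≤ N)
    (hH : (Fintype.card H : ℝ) ≤ L * (N : ℝ) ^ (2 + η)) (Q : Finset H)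
    (hQ : ∀ i, ∀ q ∈ Q, ∀ q' ∈ Q, ∃ u ∈ C i, ∃ u' ∈ C i, q - q' = u' - u) :
    (M : ℝ) * Q.card ≤ (N : ℝ) ^ (1 + η) := by
  have hL := one_le_L hH
  have h := sum_card_AB_mul_core_le hS univ Q fun i _ => hQ i
  rw [sum_profile univ (fun i => (hc i).1) (fun i => (hc i).2.1), card_univ, Fintype.card_fin]
    at h
  have hR : (L : ℝ) * (N * M) * Q.card ≤ L * (N : ℝ) ^ (2 + η) := by
    refine le_trans ?_ hH; exact_mod_cast h
  have hLpos : (0 : ℝ) < L := by exact_mod_cast (by omega : 0 < L)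
  have hNpos : (0 : ℝ) < N := by exact_mod_cast (by omega : 0 < N)
  have h2 : (N : ℝ) * M * Q.card ≤ (N : ℝ) ^ (2 + η) := by
    have := le_of_mul_le_mul_left (by linarith [hR] : (L : ℝ) * (N * M * Q.card) ≤ L * N ^ (2 + η))
      hLpos
    linarith
  have h3 : (N : ℝ) ^ (2 + η) = N * (N : ℝ) ^ (1 + η) := by
    rw [show (2 : ℝ) + η = 1 + (1 + η) by ring, Real.rpow_add hNpos, Real.rpow_one]
  rw [h3] at h2
  have h4 : (N : ℝ) * (M * Q.card) ≤ N * (N : ℝ) ^ (1 + η) := by linarith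
  exact le_of_mul_le_mul_left h4 hNpos

/-- B-cores are tiny: `|R| ≤ N^η` for every `R` with `R − R ⊆ ⋂ᵢ (Bᵢ − Bᵢ)`; so the middle
sets of a thin near-tight family share (up to translation) almost nothing. [new, elementary] -/
theorem thin_core_B (hS : IsSTPP A B C)
    (hc : ∀ i, (A i).card = N ∧ (B i).card = M ∧ (C i).card = N) (hN : 2 ≤ N)
    (hH : (Fintype.card H : ℝ) ≤ L * (N : ℝ) ^ (2 + η)) (R : Finset H)
    (hR : ∀ i, ∀ r ∈ R, ∀ r' ∈ R, ∃ t ∈ B i, ∃ t' ∈ B i, r - r' = t' - t) :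
    (R.card : ℝ) ≤ (N : ℝ) ^ η := by
  have hL := one_le_L hH
  have h := sum_card_AC_mul_core_le hS univ R fun i _ => hR i
  rw [sum_profile univ (fun i => (hc i).1) (fun i => (hc i).2.2), card_univ, Fintype.card_fin]
    at h
  have hR' : (L : ℝ) * (N * N) * R.card ≤ L * (N : ℝ) ^ (2 + η) := by
    refine le_trans ?_ hH; exact_mod_cast h
  have hLpos : (0 : ℝ) < L := by exact_mod_cast (by omega : 0 < L)
  have hNpos : (0 : ℝ) < N := by exact_mod_cast (by omega : 0 < N)
  have h2 : (N : ℝ) * N * R.card ≤ (N : ℝ) ^ (2 + η) := by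
    have := le_of_mul_le_mul_left (by linarith [hR'] : (L : ℝ) * (N * N * R.card) ≤ L * N ^ (2 + η))
      hLpos
    linarith
  have h3 : (N : ℝ) ^ (2 + η) = N * N * (N : ℝ) ^ η := by
    rw [Real.rpow_add hNpos, Real.rpow_two]; ring
  rw [h3] at h2
  have hNN : (0 : ℝ) < N * N := mul_pos hNpos hNpos
  have h4 : (N : ℝ) * N * R.card ≤ N * N * (N : ℝ) ^ η := h2
  exact le_of_mul_le_mul_left h4 hNN

/-- **No leg of translates, A.**  If the A-differences are nested, `A_{i₀} − A_{i₀} ⊆ Aᵢ − Aᵢ`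
for all `i` (e.g. all `Aᵢ` translates of one set), a thin near-tight family needs `a ≤ η` — the
trivial exponent of the split/coset designs.  [new, elementary] -/
theorem no_thin_nested_A (hηa : η < a) :
    ¬ ∃ (H : Type) (_ : AddCommGroup H) (_ : Fintype H) (L N M : ℕ) (A B C : Fin L → Finset H)
      (i₀ : Fin L), IsSTPP A B C ∧ (∀ i, (A i).card = N ∧ (B i).card = M ∧ (C i).card = N) ∧
      2 ≤ N ∧ (N : ℝ) ^ a ≤ M ∧ (Fintype.card H : ℝ) ≤ L * (N : ℝ) ^ (2 + η) ∧
      (∀ i, ∀ p ∈ A i₀, ∀ p' ∈ A i₀, ∃ s ∈ A i, ∃ s' ∈ A i, p - p' = s' - s) := by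
  rintro ⟨H, _, _, L, N, M, A, B, C, i₀, hS, hc, hN, hM, hH, hT⟩
  have h := thin_core_A hS hc hN hH (A i₀) hT
  rw [(hc i₀).1] at h
  have hN1 : (1 : ℝ) < N := by exact_mod_cast (by omega : 1 < N)
  have hNpos : (0 : ℝ) < N := by linarith
  have h2 : (M : ℝ) ≤ (N : ℝ) ^ η := by
    rw [Real.rpow_add hNpos, Real.rpow_one, mul_comm] at h
    exact le_of_mul_le_mul_left h hNpos
  have h3 : (N : ℝ) ^ a ≤ (N : ℝ) ^ η := hM.trans h2
  have h4 : a ≤ η := (Real.rpow_le_rpow_left_iff hN1).1 h3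
  linarith

/-- **No leg of translates, C** (nested C-differences `C_{i₀} − C_{i₀} ⊆ Cᵢ − Cᵢ`).
[new, elementary] -/
theorem no_thin_nested_C (hηa : η < a) :
    ¬ ∃ (H : Type) (_ : AddCommGroup H) (_ : Fintype H) (L N M : ℕ) (A B C : Fin L → Finset H)
      (i₀ : Fin L), IsSTPP A B C ∧ (∀ i, (A i).card = N ∧ (B i).card = M ∧ (C i).card = N) ∧
      2 ≤ N ∧ (N : ℝ) ^ a ≤ M ∧ (Fintype.card H : ℝ) ≤ L * (N : ℝ) ^ (2 + η) ∧
      (∀ i, ∀ q ∈ C i₀, ∀ q' ∈ C i₀, ∃ u ∈ C i, ∃ u' ∈ C i, q - q' = u' - u) := by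
  rintro ⟨H, _, _, L, N, M, A, B, C, i₀, hS, hc, hN, hM, hH, hT⟩
  have h := thin_core_C hS hc hN hH (C i₀) hT
  rw [(hc i₀).2.2] at h
  have hN1 : (1 : ℝ) < N := by exact_mod_cast (by omega : 1 < N)
  have hNpos : (0 : ℝ) < N := by linarith
  have h2 : (M : ℝ) ≤ (N : ℝ) ^ η := by
    rw [Real.rpow_add hNpos, Real.rpow_one, mul_comm] at h
    exact le_of_mul_le_mul_left h hNpos
  have h4 : a ≤ η := (Real.rpow_le_rpow_left_iff hN1).1 (hM.trans h2)
  linarith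

/-- **No leg of translates, B** (nested middle differences `B_{i₀} − B_{i₀} ⊆ Bᵢ − Bᵢ`, e.g. a
COMMON middle set, or middles that are translates of one set). [new, elementary] -/
theorem no_thin_nested_B (hηa : η < a) :
    ¬ ∃ (H : Type) (_ : AddCommGroup H) (_ : Fintype H) (L N M : ℕ) (A B C : Fin L → Finset H)
      (i₀ : Fin L), IsSTPP A B C ∧ (∀ i, (A i).card = N ∧ (B i).card = M ∧ (C i).card = N) ∧
      2 ≤ N ∧ (N : ℝ) ^ a ≤ M ∧ (Fintype.card H : ℝ) ≤ L * (N : ℝ) ^ (2 + η) ∧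
      (∀ i, ∀ r ∈ B i₀, ∀ r' ∈ B i₀, ∃ t ∈ B i, ∃ t' ∈ B i, r - r' = t' - t) := by
  rintro ⟨H, _, _, L, N, M, A, B, C, i₀, hS, hc, hN, hM, hH, hT⟩
  have h := thin_core_B hS hc hN hH (B i₀) hT
  rw [(hc i₀).2.1] at h
  have hN1 : (1 : ℝ) < N := by exact_mod_cast (by omega : 1 < N)
  have h4 : a ≤ η := (Real.rpow_le_rpow_left_iff hN1).1 (hM.trans h)
  linarith

/-- **Translation classes.**  If the blocks fall into `K` classes such that within a class the
A-differences are nested (e.g. the `Aᵢ` of a class are translates of each other), then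
`M ≤ K·N^η`: a thin near-tight family meets at least `M·N^{−η} ≥ N^{a−η}` classes in each leg
(pigeonhole + `sum_card_BC_mul_core_le` on the largest class). [new, elementary] -/
theorem thin_classes_A (hS : IsSTPP A B C)
    (hc : ∀ i, (A i).card = N ∧ (B i).card = M ∧ (C i).card = N) (hN : 2 ≤ N)
    (hH : (Fintype.card H : ℝ) ≤ L * (N : ℝ) ^ (2 + η)) {K : ℕ} (cls : Fin L → Fin K)
    (hcls : ∀ i j, cls i = cls j → ∀ p ∈ A j, ∀ p' ∈ A j, ∃ s ∈ A i, ∃ s' ∈ A i,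
      p - p' = s' - s) :
    (M : ℝ) ≤ K * (N : ℝ) ^ η := by
  classical
  have hL := one_le_L hH
  set fib : Fin K → Finset (Fin L) := fun c => univ.filter fun i => cls i = c with hfib
  -- pigeonhole: some class has `L ≤ K · |fibre|`
  have hKpos : 0 < K := Fin.pos (cls ⟨0, hL⟩)
  have hsum : ∑ c : Fin K, (fib c).card = L := by
    rw [hfib, ← Finset.card_eq_sum_card_fiberwise (f := cls) (s := univ) (t := univ)
      fun i _ => mem_univ _, card_univ, Fintype.card_fin]
  obtain ⟨c, -, hcL⟩ : ∃ c ∈ (univ : Finset (Fin K)), L ≤ K * (fib c).card := by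
    refine Finset.exists_le_of_sum_le (univ_nonempty_iff.2 ⟨⟨0, hKpos⟩⟩) ?_
    rw [sum_const, card_univ, Fintype.card_fin, smul_eq_mul, ← Finset.mul_sum, hsum]
  have hSpos : 0 < (fib c).card := by
    by_contra h0; push Not at h0
    have : (fib c).card = 0 := by omega
    rw [this, mul_zero] at hcL; omega
  obtain ⟨j₀, hj₀⟩ := card_pos.1 hSpos
  have hj₀c : cls j₀ = c := (mem_filter.1 hj₀).2
  have h := sum_card_BC_mul_core_le hS (fib c) (A j₀) fun i hi p hp p' hp' =>
    hcls i j₀ ((mem_filter.1 hi).2.trans hj₀c.symm) p hp p' hp'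
  rw [sum_profile (fib c) (fun i => (hc i).2.1) (fun i => (hc i).2.2), (hc j₀).1] at h
  -- `|fib| · M · N · N ≤ |H| ≤ L N^{2+η} ≤ K |fib| N^{2+η}`
  have hNpos : (0 : ℝ) < N := by exact_mod_cast (by omega : 0 < N)
  have hF : (0 : ℝ) < (fib c).card := by exact_mod_cast hSpos
  have h1 : ((fib c).card : ℝ) * (M * N) * N ≤ L * (N : ℝ) ^ (2 + η) := by
    refine le_trans ?_ hH; exact_mod_cast h
  have hcL' : (L : ℝ) ≤ K * (fib c).card := by exact_mod_cast hcL
  have h2 : ((fib c).card : ℝ) * (M * N) * N ≤ K * (fib c).card * (N : ℝ) ^ (2 + η) := by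
    refine h1.trans ?_
    exact mul_le_mul_of_nonneg_right hcL' (by positivity)
  rw [Real.rpow_add hNpos, Real.rpow_two] at h2
  have h3 : ((fib c).card * (N * N) : ℝ) * M ≤ ((fib c).card * (N * N)) * (K * (N : ℝ) ^ η) := by
    linarith
  exact le_of_mul_le_mul_left h3 (by positivity)

end Thin


end Summit.MatrixMultiplication.MatrixMultiplication.Theorems.ThinPackings.Negative
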